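import Summits.CriticalPhenomena.CardyFormulaZ2.Theorems.CardyMagicRigidityNestingRigidityNeckZ2RingArc
import HarnessLib

/-!
# Crux `NestingRigidity`, line `pinch-resampling` (v4), stub S12: arc cells of fixed phase, rotated cell indices, and the cut

Crux `Summit.CriticalPhenomena.CardyFormulaZ2.Theses.CardyMagicRigidity.NestingRigidity`
(stmt-CriticalPhenomena-4835), line `pinch-resampling` v4, stub S12 `stub_neckHookupCoarseZ2 : NeckHookupCoarseZ2`.
Geometric brick of the summation of the necklace bound `ZNodeAbsBoundChainA` (amended plan in the module
docstring of `…NestingRigidityGapEntropy`, worker W6a), companion of `…NeckZ2RingCells`.  There the ring was cut at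
an arbitrary arc position; but when `ℓ ∤ 8R` the cells of two different cuts do not correspond, which makes the
choice of the cut (inside a largest empty gap) awkward.  Here the cells have a FIXED phase — `cellIdx R ℓ d =
⌊arcPos R d / ℓ⌋ ∈ [0, Nc)`, `Nc = ⌈8R / ℓ⌉` — and the rotation acts on cell INDICES:
`rotIdx Nc a₀ C = C - a₀ (mod Nc) ∈ [0, Nc)`.  Everything is linear integer arithmetic.

* §1 `cellIdx`, `rotIdx`, ranges; the dictionary with the sup norm for ring points `d, d'` with rotated indices
  `ρ, ρ'`, `Δ = |ρ - ρ'|`: `zNorm_sub_lt_of_rotIdx` (`|d - d'|_∞ < (Δ + 1) ℓ`, needs `8R ≤ Nc ℓ`) and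
  `le_two_mul_zNorm_sub_of_rotIdx` (`min (ℓ Δ, ℓ (Nc - Δ)) - 2ℓ + 1 ≤ 2 |d - d'|_∞`, needs `(Nc - 1) ℓ < 8R`).
* §2 `idxPt R ℓ Nc a₀ t` — a ring point whose rotated index is `t` (`zNorm_idxPt`, `rotIdx_cellIdx_idxPt`): the
  centres of node and arm annuli, computed from the skeleton alone.
* §3 **The cut** (`exists_good_cut`, registered anchor `ringIndexCells_cut`): for a nonempty finite set `C₀` of cell
  indices in `[0, Nc)` there is `a₀ ∈ C₀` such that, for the rotated indices `ρ(C) = rotIdx Nc a₀ C`, `ρ(a₀) = 0` and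
  every gap between consecutive rotated values is at most the WRAP GAP `Nc - max ρ`: take `a₀` minimising `max ρ`
  (re-cutting at the upper end of a larger inner gap would decrease the maximum).  Consequently a line gap `G` between
  rotated cells certifies a cyclic cell distance `≥ G` both ways round, i.e. a sup distance `≥ (ℓ G - 2ℓ + 1) / 2`.
-/

noncomputable section

namespace Summit.CriticalPhenomena.CardyFormulaZ2.Cruxes.NestingRigidity.PinchResampling

open Literature.Probability.Percolation Literature.Probability.LatticeModels
open ZPinchLocality

namespace NeckCoarseZ2

/-! ## §1 Cells of fixed phase and rotated indices -/

/-- **Cell index** of a ring offset at resolution `ℓ` (fixed phase): `⌊arcPos / ℓ⌋`. -/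
def cellIdx (R ℓ : ℤ) (d : Site 2) : ℤ := arcPos R d / ℓ

/-- **Rotated cell index**: `C - a₀ (mod Nc)`, computed without `%`. -/
def rotIdx (Nc a₀ C : ℤ) : ℤ := if a₀ ≤ C then C - a₀ else C - a₀ + Nc

variable {R ℓ Nc a₀ : ℤ} {d d' : Site 2}

/-- The arc position lies in its cell: `ℓ C ≤ a < ℓ C + ℓ`. -/
theorem cellIdx_mul_le (hℓ : 0 < ℓ) (d : Site 2) :
    ℓ * cellIdx R ℓ d ≤ arcPos R d ∧ arcPos R d < ℓ * cellIdx R ℓ d + ℓ := by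
  have h := Int.mul_ediv_add_emod (arcPos R d) ℓ
  have h0 := Int.emod_nonneg (arcPos R d) hℓ.ne'
  have h1 := Int.emod_lt_of_pos (arcPos R d) hℓ
  unfold cellIdx
  constructor <;> omega

/-- The cell index is nonnegative. -/
theorem cellIdx_nonneg (hℓ : 0 < ℓ) (hd : zNorm d = R) : 0 ≤ cellIdx R ℓ d :=
  Int.ediv_nonneg (arcPos_nonneg hd) hℓ.le

/-- The cell index is `< Nc` as soon as `8R ≤ Nc ℓ`. -/
theorem cellIdx_lt (hℓ : 0 < ℓ) (hR : 1 ≤ R) (hd : zNorm d = R) (hNc : 8 * R ≤ Nc * ℓ) : cellIdx R ℓ d < Nc := by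
  have h := (cellIdx_mul_le hℓ d (R := R)).1
  have h' := arcPos_lt hR hd
  by_contra hcon
  have hcon' : Nc ≤ cellIdx R ℓ d := le_of_not_gt hcon
  have : Nc * ℓ ≤ ℓ * cellIdx R ℓ d := by nlinarith
  omega

/-- The rotated index is nonnegative (`a₀ < Nc`, `0 ≤ C`). -/
theorem rotIdx_nonneg {C : ℤ} (ha₀ : a₀ < Nc) (hC : 0 ≤ C) : 0 ≤ rotIdx Nc a₀ C := by
  unfold rotIdx
  split_ifs <;> omega

/-- The rotated index is `< Nc` (`0 ≤ a₀`, `C < Nc`). -/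
theorem rotIdx_lt {C : ℤ} (ha₀ : 0 ≤ a₀) (hC : C < Nc) : rotIdx Nc a₀ C < Nc := by
  unfold rotIdx
  split_ifs <;> omega

/-- The rotated index of the cut itself is `0`. -/
theorem rotIdx_self : rotIdx Nc a₀ a₀ = 0 := by
  simp [rotIdx]

/-- **Sup distance `<` (rotated index distance `+ 1`) `· ℓ`** for two ring points (`8R ≤ Nc ℓ`, cut `a₀ ∈ [0, Nc)`). -/
theorem zNorm_sub_lt_of_rotIdx (hℓ : 0 < ℓ) (hR : 1 ≤ R) (hNc : 8 * R ≤ Nc * ℓ) (hd : zNorm d = R)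
    (hd' : zNorm d' = R) :
    zNorm (d - d') < (|rotIdx Nc a₀ (cellIdx R ℓ d) - rotIdx Nc a₀ (cellIdx R ℓ d')| + 1) * ℓ := by
  have h1 := zNorm_sub_le_arcDist hd hd'
  have h2 := zNorm_sub_le_arcDist' hd hd'
  obtain ⟨hX1, hX2⟩ := cellIdx_mul_le hℓ d (R := R)
  obtain ⟨hY1, hY2⟩ := cellIdx_mul_le hℓ d' (R := R)
  have hC0 := cellIdx_nonneg hℓ hd
  have hC1 := cellIdx_lt hℓ hR hd hNc
  have hD0 := cellIdx_nonneg hℓ hd'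
  have hD1 := cellIdx_lt hℓ hR hd' hNc
  set C := cellIdx R ℓ d
  set C' := cellIdx R ℓ d'
  set a := arcPos R d
  set a' := arcPos R d'
  -- multiply the rotated indices by `ℓ` to stay linear
  have key : (|rotIdx Nc a₀ C - rotIdx Nc a₀ C'| + 1) * ℓ = |ℓ * rotIdx Nc a₀ C - ℓ * rotIdx Nc a₀ C'| + ℓ := by
    rw [← mul_sub, abs_mul, abs_of_pos hℓ]; ring
  rw [key]
  have hXC : ℓ * (C - C') = ℓ * C - ℓ * C' := mul_sub _ _ _
  have hrot : ∀ E : ℤ, ℓ * rotIdx Nc a₀ E = if a₀ ≤ E then ℓ * E - ℓ * a₀ else ℓ * E - ℓ * a₀ + Nc * ℓ := by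
    intro E
    unfold rotIdx
    split_ifs <;> ring
  have hmonoC : (a₀ ≤ C → ℓ * a₀ ≤ ℓ * C) ∧ (C < a₀ → ℓ * C + ℓ ≤ ℓ * a₀) :=
    ⟨fun h ↦ mul_le_mul_of_nonneg_left h hℓ.le, fun h ↦ by nlinarith⟩
  have hmonoC' : (a₀ ≤ C' → ℓ * a₀ ≤ ℓ * C') ∧ (C' < a₀ → ℓ * C' + ℓ ≤ ℓ * a₀) :=
    ⟨fun h ↦ mul_le_mul_of_nonneg_left h hℓ.le, fun h ↦ by nlinarith⟩
  have hCC : (C ≤ C' → ℓ * C ≤ ℓ * C') ∧ (C' < C → ℓ * C' + ℓ ≤ ℓ * C) :=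
    ⟨fun h ↦ mul_le_mul_of_nonneg_left h hℓ.le, fun h ↦ by nlinarith⟩
  have hCN : ℓ * C + ℓ ≤ Nc * ℓ := by nlinarith
  have hCN' : ℓ * C' + ℓ ≤ Nc * ℓ := by nlinarith
  have hC0' : 0 ≤ ℓ * C := by positivity
  have hD0' : 0 ≤ ℓ * C' := by positivity
  rw [hrot C, hrot C']
  rw [abs_eq_max_neg] at h1 h2 ⊢
  rcases le_or_gt C C' with hle | hlt
  · have := hCC.1 hle
    split_ifs <;> omega
  · have := hCC.2 hlt
    split_ifs <;> omega

/-- **Conversely**: `min (ℓ Δ, ℓ (Nc - Δ)) - 2ℓ + 1 ≤ 2 |d - d'|_∞`, `Δ` the rotated index distance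
(`(Nc - 1) ℓ < 8R ≤ Nc ℓ`). -/
theorem le_two_mul_zNorm_sub_of_rotIdx (hℓ : 0 < ℓ) (hR : 1 ≤ R) (hNc : 8 * R ≤ Nc * ℓ)
    (hNc' : (Nc - 1) * ℓ < 8 * R) (hd : zNorm d = R) (hd' : zNorm d' = R) :
    min (ℓ * |rotIdx Nc a₀ (cellIdx R ℓ d) - rotIdx Nc a₀ (cellIdx R ℓ d')|)
      (ℓ * (Nc - |rotIdx Nc a₀ (cellIdx R ℓ d) - rotIdx Nc a₀ (cellIdx R ℓ d')|)) - 2 * ℓ + 1 ≤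
      2 * zNorm (d - d') := by
  have h := arcDist_le_two_mul_zNorm_sub hd hd'
  obtain ⟨hX1, hX2⟩ := cellIdx_mul_le hℓ d (R := R)
  obtain ⟨hY1, hY2⟩ := cellIdx_mul_le hℓ d' (R := R)
  have hC0 := cellIdx_nonneg hℓ hd
  have hC1 := cellIdx_lt hℓ hR hd hNc
  have hD0 := cellIdx_nonneg hℓ hd'
  have hD1 := cellIdx_lt hℓ hR hd' hNc
  set C := cellIdx R ℓ d
  set C' := cellIdx R ℓ d'
  set a := arcPos R d
  set a' := arcPos R d'
  have key1 : ℓ * |rotIdx Nc a₀ C - rotIdx Nc a₀ C'| = |ℓ * rotIdx Nc a₀ C - ℓ * rotIdx Nc a₀ C'| := by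
    rw [← mul_sub, abs_mul, abs_of_pos hℓ]
  have key2 : ℓ * (Nc - |rotIdx Nc a₀ C - rotIdx Nc a₀ C'|) = Nc * ℓ - |ℓ * rotIdx Nc a₀ C - ℓ * rotIdx Nc a₀ C'| := by
    rw [mul_sub, key1]; ring
  rw [key1, key2]
  have hrot : ∀ E : ℤ, ℓ * rotIdx Nc a₀ E = if a₀ ≤ E then ℓ * E - ℓ * a₀ else ℓ * E - ℓ * a₀ + Nc * ℓ := by
    intro E
    unfold rotIdx
    split_ifs <;> ring
  have hmonoC : (a₀ ≤ C → ℓ * a₀ ≤ ℓ * C) ∧ (C < a₀ → ℓ * C + ℓ ≤ ℓ * a₀) :=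
    ⟨fun h ↦ mul_le_mul_of_nonneg_left h hℓ.le, fun h ↦ by nlinarith⟩
  have hmonoC' : (a₀ ≤ C' → ℓ * a₀ ≤ ℓ * C') ∧ (C' < a₀ → ℓ * C' + ℓ ≤ ℓ * a₀) :=
    ⟨fun h ↦ mul_le_mul_of_nonneg_left h hℓ.le, fun h ↦ by nlinarith⟩
  have hCC : (C ≤ C' → ℓ * C ≤ ℓ * C') ∧ (C' < C → ℓ * C' + ℓ ≤ ℓ * C) :=
    ⟨fun h ↦ mul_le_mul_of_nonneg_left h hℓ.le, fun h ↦ by nlinarith⟩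
  have hCN : ℓ * C + ℓ ≤ Nc * ℓ := by nlinarith
  have hCN' : ℓ * C' + ℓ ≤ Nc * ℓ := by nlinarith
  have hC0' : 0 ≤ ℓ * C := by positivity
  have hD0' : 0 ≤ ℓ * C' := by positivity
  have hNl : (Nc - 1) * ℓ = Nc * ℓ - ℓ := by ring
  rw [hNl] at hNc'
  rw [hrot C, hrot C']
  rw [abs_eq_max_neg] at h ⊢
  rcases le_or_gt C C' with hle | hlt
  · have := hCC.1 hle
    split_ifs <;> omega
  · have := hCC.2 hlt
    split_ifs <;> omega

/-! ## §2 Ring points of rotated indices -/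

/-- **A ring point of rotated index `t`**: the first point of the cell `t + a₀ (mod Nc)`. -/
def idxPt (R ℓ Nc a₀ t : ℤ) : Site 2 := arcPt R (ℓ * (if t + a₀ < Nc then t + a₀ else t + a₀ - Nc))

variable {t : ℤ}

/-- The un-rotated cell of `idxPt` is nonneg and `< Nc` (`0 ≤ t < Nc`, `0 ≤ a₀ < Nc`). -/
theorem idxPt_cell_range (ha₀ : 0 ≤ a₀) (ha₀' : a₀ < Nc) (ht : 0 ≤ t) (ht' : t < Nc) :
    0 ≤ (if t + a₀ < Nc then t + a₀ else t + a₀ - Nc) ∧ (if t + a₀ < Nc then t + a₀ else t + a₀ - Nc) < Nc := by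
  split_ifs <;> omega

/-- `idxPt` lies on the ring (`(Nc - 1) ℓ < 8R`). -/
theorem zNorm_idxPt (hℓ : 0 < ℓ) (hNc' : (Nc - 1) * ℓ < 8 * R) (ha₀ : 0 ≤ a₀) (ha₀' : a₀ < Nc) (ht : 0 ≤ t)
    (ht' : t < Nc) : zNorm (idxPt R ℓ Nc a₀ t) = R := by
  obtain ⟨h0, h1⟩ := idxPt_cell_range ha₀ ha₀' ht ht' (t := t)
  set m := (if t + a₀ < Nc then t + a₀ else t + a₀ - Nc) with hm
  have hm1 : ℓ * m ≤ (Nc - 1) * ℓ := by nlinarith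
  unfold idxPt
  rw [← hm]
  exact zNorm_arcPt (by positivity) (by omega)

/-- The cell index of `idxPt` is `t + a₀ (mod Nc)`. -/
theorem cellIdx_idxPt (hℓ : 0 < ℓ) (hNc' : (Nc - 1) * ℓ < 8 * R) (ha₀ : 0 ≤ a₀) (ha₀' : a₀ < Nc) (ht : 0 ≤ t)
    (ht' : t < Nc) : cellIdx R ℓ (idxPt R ℓ Nc a₀ t) = (if t + a₀ < Nc then t + a₀ else t + a₀ - Nc) := by
  obtain ⟨h0, h1⟩ := idxPt_cell_range ha₀ ha₀' ht ht' (t := t)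
  set m := (if t + a₀ < Nc then t + a₀ else t + a₀ - Nc) with hm
  have hm1 : ℓ * m ≤ (Nc - 1) * ℓ := by nlinarith
  unfold idxPt cellIdx
  rw [← hm, arcPos_arcPt (by omega), Int.mul_ediv_cancel_left _ hℓ.ne']

/-- **The rotated index of `idxPt R ℓ Nc a₀ t` is `t`.** -/
theorem rotIdx_cellIdx_idxPt (hℓ : 0 < ℓ) (hNc' : (Nc - 1) * ℓ < 8 * R) (ha₀ : 0 ≤ a₀) (ha₀' : a₀ < Nc)
    (ht : 0 ≤ t) (ht' : t < Nc) : rotIdx Nc a₀ (cellIdx R ℓ (idxPt R ℓ Nc a₀ t)) = t := by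
  rw [cellIdx_idxPt hℓ hNc' ha₀ ha₀' ht ht']
  unfold rotIdx
  split_ifs <;> omega

/-! ## §3 The cut inside a largest gap -/

/-- Re-cutting: the rotated index for the cut `a₁` in terms of the one for the cut `a₀`, when `ρ₀(a₁) = v`. -/
theorem rotIdx_recut {a₁ C v : ℤ} (ha₀ : 0 ≤ a₀) (ha₀' : a₀ < Nc) (ha₁ : 0 ≤ a₁) (ha₁' : a₁ < Nc) (hC : 0 ≤ C)
    (hC' : C < Nc) (hv : rotIdx Nc a₀ a₁ = v) :
    rotIdx Nc a₁ C = if v ≤ rotIdx Nc a₀ C then rotIdx Nc a₀ C - v else rotIdx Nc a₀ C - v + Nc := by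
  unfold rotIdx at hv ⊢
  split_ifs at hv ⊢ <;> omega

/-- **The good cut**: for a nonempty finite set `C₀ ⊆ [0, Nc)` of cell indices there is `a₀ ∈ C₀` such that, with
`ρ = rotIdx Nc a₀` and `M = max_{C₀} ρ`, every gap between consecutive values of `ρ` on `C₀` is at most the wrap gap
`Nc - M`: if `u < v` are values of `ρ` on `C₀` with no value strictly in between, then `v - u ≤ Nc - M`. -/
theorem exists_good_cut (C₀ : Finset ℤ) (hne : C₀.Nonempty) (hC₀ : ∀ C ∈ C₀, 0 ≤ C ∧ C < Nc) :
    ∃ a₀ ∈ C₀, ∀ u ∈ C₀, ∀ v ∈ C₀, rotIdx Nc a₀ u < rotIdx Nc a₀ v →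
      (∀ z ∈ C₀, rotIdx Nc a₀ z ≤ rotIdx Nc a₀ u ∨ rotIdx Nc a₀ v ≤ rotIdx Nc a₀ z) →
      ∀ w ∈ C₀, rotIdx Nc a₀ v - rotIdx Nc a₀ u ≤ Nc - rotIdx Nc a₀ w := by
  classical
  -- `a₀` minimises the largest rotated index
  set f : ℤ → ℤ := fun a ↦ (C₀.image (rotIdx Nc a)).max' (hne.image _) with hf
  obtain ⟨a₀, ha₀, hmin⟩ := C₀.exists_min_image f hne
  have hfle : ∀ a w, w ∈ C₀ → rotIdx Nc a w ≤ f a := fun a w hw ↦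
    Finset.le_max' _ _ (Finset.mem_image_of_mem _ hw)
  refine ⟨a₀, ha₀, fun u hu v hv huv hgap w hw ↦ ?_⟩
  -- re-cut at `v`
  obtain ⟨ha₀0, ha₀1⟩ := hC₀ a₀ ha₀
  obtain ⟨hv0, hv1⟩ := hC₀ v hv
  have hM : f v ≤ max (f a₀ - rotIdx Nc a₀ v) (Nc - (rotIdx Nc a₀ v - rotIdx Nc a₀ u)) := by
    refine Finset.max'_le _ _ _ fun y hy ↦ ?_
    obtain ⟨z, hz, rfl⟩ := Finset.mem_image.1 hy
    obtain ⟨hz0, hz1⟩ := hC₀ z hz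
    rw [rotIdx_recut ha₀0 ha₀1 hv0 hv1 hz0 hz1 rfl]
    have hfz := hfle a₀ z hz
    rcases hgap z hz with h | h
    · split_ifs with h'
      · exact le_max_of_le_left (by omega)
      · exact le_max_of_le_right (by omega)
    · rw [if_pos h]
      exact le_max_of_le_left (by omega)
  have hmin' : f a₀ ≤ f v := hmin v hv
  have hu0 : 0 ≤ rotIdx Nc a₀ u := rotIdx_nonneg ha₀1 (hC₀ u hu).1
  have hfw := hfle a₀ w hw
  rcases le_max_iff.1 (hmin'.trans hM) with h | h
  · omega
  · omega

end NeckCoarseZ2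

/-- **The cut of the ring cells inside a largest gap (registered helper, anchor of this module on the crux item)**:
for a nonempty finite set of cell indices in `[0, Nc)` there is a cut `a₀` in the set such that every gap between
consecutive rotated indices is at most the wrap gap `Nc - ρ(w)` for every `w` in the set
(`NeckCoarseZ2.exists_good_cut`). -/
theorem ringIndexCells_cut : ∀ (Nc : ℤ) (C₀ : Finset ℤ), C₀.Nonempty → (∀ C ∈ C₀, 0 ≤ C ∧ C < Nc) → ∃ a₀ ∈ C₀, ∀ u ∈ C₀, ∀ v ∈ C₀, NeckCoarseZ2.rotIdx Nc a₀ u < NeckCoarseZ2.rotIdx Nc a₀ v → (∀ z ∈ C₀, NeckCoarseZ2.rotIdx Nc a₀ z ≤ NeckCoarseZ2.rotIdx Nc a₀ u ∨ NeckCoarseZ2.rotIdx Nc a₀ v ≤ NeckCoarseZ2.rotIdx Nc a₀ z) → ∀ w ∈ C₀, NeckCoarseZ2.rotIdx Nc a₀ v - NeckCoarseZ2.rotIdx Nc a₀ u ≤ Nc - NeckCoarseZ2.rotIdx Nc a₀ w :=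
  fun _ C₀ hne hC₀ ↦ NeckCoarseZ2.exists_good_cut C₀ hne hC₀

end Summit.CriticalPhenomena.CardyFormulaZ2.Cruxes.NestingRigidity.PinchResampling

end
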